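import Literature.Probability.LatticeModels.LatticeLaplacianZd
import Mathlib.Analysis.SpecialFunctions.Pow.Deriv
import Mathlib.Analysis.Calculus.MeanValue
import HarnessLib

/-!
# Route `InverseSquareTelemetry`, item `EtaBoundsFromTelemetry` (stmt-CriticalPhenomena-4499),
# helper file 1: the six-neighbour Laplacian of the radial powers `|x|₂^{-2p}` on `ℤ³`

THEOREM-ONLY file (no definitions, no named facts), `--supports stmt-CriticalPhenomena-4499`.

Writing `s(x) = ∑ᵢ xᵢ²` (so `|x|₂ = √s`) and `Δ` for the graph Laplacian `latticeLaplacianZd` of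
`ℤ³`, the neighbours of `x` have `s(x ± eᵢ) = s ± 2xᵢ + 1`, so
`Δ (s^{-p})(x) = ∑_{h} (φ(s + h) - φ(s))` with `φ(u) = u^{-p}` and the six increments
`h ∈ {1 + 2xᵢ, 1 - 2xᵢ}`, `∑ h = 6`, `∑ h² = 6 + 8s`, `|h| ≤ 3√s`. A third-order Taylor bound for
`φ` (proved here from the mean value inequality, iterated three times) gives the **lattice Taylor
expansion**

  `|Δ (s^{-p})(x) - 2p(2p-1) s^{-p-1}| ≤ K_p s^{-p-3/2}`   (`s(x) ≥ 16`),

i.e. `Δ_{ℤ³} |x|^{-β} = β(β-1)|x|^{-β-2} + O(|x|^{-β-3})` — the continuum value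
`Δ_{ℝ³} r^{-β} = β(β-1) r^{-β-2}` up to one order. This is the input for the barrier functions of
the a-priori bounds (`…Barriers.lean`).

References: G. F. Lawler, V. Limic, *Random Walk: A Modern Introduction* (2010), §6.2 (discrete
Taylor estimates for the Laplacian of smooth radial functions); the statements are elementary.
-/

noncomputable section

namespace Summit.CriticalPhenomena.Ising3DConformalLimit.Theorems.EtaBoundsFromTelemetry

open Literature.Probability.LatticeModels Finset Set

/-! ### One-dimensional calculus: `u ↦ u^{-p}` to third order -/

/-- Mean value inequality in the form used below: if `g a = 0` and `|g'| ≤ B` on the unordered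
interval `[a, b]`, then `|g t| ≤ B |t - a|` there. [folklore] -/
theorem abs_le_of_hasDerivAt_bound {g g' : ℝ → ℝ} {a b B : ℝ}
    (hder : ∀ t ∈ uIcc a b, HasDerivAt g (g' t) t) (hbound : ∀ t ∈ uIcc a b, |g' t| ≤ B)
    (hg0 : g a = 0) : ∀ t ∈ uIcc a b, |g t| ≤ B * |t - a| := by
  intro t ht
  have key := (convex_uIcc a b).norm_image_sub_le_of_norm_hasDerivWithin_le
    (fun u hu => (hder u hu).hasDerivWithinAt)
    (fun u hu => by rw [Real.norm_eq_abs]; exact hbound u hu) left_mem_uIcc ht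
  rwa [hg0, sub_zero, Real.norm_eq_abs, Real.norm_eq_abs] at key

/-- Points of `[s, s + h]` (unordered) lie within `|h|` of `s`. [folklore] -/
theorem abs_sub_le_of_mem_uIcc {s h t : ℝ} (ht : t ∈ uIcc s (s + h)) : |t - s| ≤ |h| := by
  rcases mem_uIcc.1 ht with ⟨h1, h2⟩ | ⟨h1, h2⟩
  · rw [abs_le]
    constructor <;> linarith [le_abs_self h, neg_abs_le h]
  · rw [abs_le]
    constructor <;> linarith [le_abs_self h, neg_abs_le h]

/-- **Third-order Taylor bound for `u ↦ u^{-p}`** (`p > 0`): if `0 < m ≤ s` and `m ≤ s + h`, then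
`|(s+h)^{-p} - s^{-p} + p s^{-p-1} h - p(p+1) s^{-p-2} h²/2| ≤ p(p+1)(p+2) m^{-p-3} |h|³`
(the mean value inequality applied three times on `[s, s+h]`, where `|φ'''| ≤ p(p+1)(p+2)m^{-p-3}`).
[folklore] -/
theorem abs_rpow_neg_taylor_le {p m s h : ℝ} (hp : 0 < p) (hm : 0 < m) (hms : m ≤ s)
    (hmsh : m ≤ s + h) :
    |(s + h) ^ (-p) - s ^ (-p) - (-p * s ^ (-p - 1)) * h - (p * (p + 1) * s ^ (-p - 2)) * h ^ 2 / 2|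
      ≤ p * (p + 1) * (p + 2) * m ^ (-p - 3) * |h| ^ 3 := by
  -- every point of the interval is `≥ m > 0`
  have hI : ∀ t ∈ uIcc s (s + h), m ≤ t := fun t ht => by
    rcases mem_uIcc.1 ht with ⟨h1, _⟩ | ⟨h1, _⟩ <;> linarith
  have hIpos : ∀ t ∈ uIcc s (s + h), 0 < t := fun t ht => hm.trans_le (hI t ht)
  -- the derivatives of `φ, φ', φ''`
  have hd0 : ∀ t : ℝ, 0 < t → HasDerivAt (fun u : ℝ => u ^ (-p)) (-p * t ^ (-p - 1)) t :=
    fun t ht => Real.hasDerivAt_rpow_const (Or.inl ht.ne')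
  have hd1 : ∀ t : ℝ, 0 < t →
      HasDerivAt (fun u : ℝ => -p * u ^ (-p - 1)) (p * (p + 1) * t ^ (-p - 2)) t := by
    intro t ht
    have h := (Real.hasDerivAt_rpow_const (p := -p - 1) (Or.inl ht.ne')).const_mul (-p)
    refine h.congr_deriv ?_
    rw [show -p - 1 - 1 = -p - 2 by ring]
    ring
  have hd2 : ∀ t : ℝ, 0 < t →
      HasDerivAt (fun u : ℝ => p * (p + 1) * u ^ (-p - 2))
        (-(p * (p + 1) * (p + 2)) * t ^ (-p - 3)) t := by
    intro t ht
    have h := (Real.hasDerivAt_rpow_const (p := -p - 2) (Or.inl ht.ne')).const_mul (p * (p + 1))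
    refine h.congr_deriv ?_
    rw [show -p - 2 - 1 = -p - 3 by ring]
    ring
  set L : ℝ := p * (p + 1) * (p + 2) * m ^ (-p - 3) with hL
  have hL0 : 0 ≤ L := by positivity
  -- step A: `|φ''(t) - φ''(s)| ≤ L |t - s|`
  have hA : ∀ t ∈ uIcc s (s + h),
      |p * (p + 1) * t ^ (-p - 2) - p * (p + 1) * s ^ (-p - 2)| ≤ L * |t - s| := by
    refine abs_le_of_hasDerivAt_bound (g := fun t => p * (p + 1) * t ^ (-p - 2) - p * (p + 1) * s ^ (-p - 2))
      (g' := fun t => -(p * (p + 1) * (p + 2)) * t ^ (-p - 3))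
      (fun t ht => (hd2 t (hIpos t ht)).sub_const _) (fun t ht => ?_) (by simp)
    have ht := hIpos t ht
    have hmt := hI t ‹_›
    rw [abs_mul, abs_neg, abs_of_pos (by positivity : 0 < p * (p + 1) * (p + 2)),
      abs_of_pos (Real.rpow_pos_of_pos ht _), hL]
    exact mul_le_mul_of_nonneg_left (Real.rpow_le_rpow_of_nonpos hm hmt (by linarith))
      (by positivity)
  -- step B: `g₁(t) = φ'(t) - φ'(s) - φ''(s)(t - s)` has `|g₁ t| ≤ L |h| |t - s| ≤ L h²`
  have hB : ∀ t ∈ uIcc s (s + h),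
      |-p * t ^ (-p - 1) - (-p * s ^ (-p - 1)) - p * (p + 1) * s ^ (-p - 2) * (t - s)|
        ≤ L * |h| * |t - s| := by
    refine abs_le_of_hasDerivAt_bound
      (g := fun t => -p * t ^ (-p - 1) - (-p * s ^ (-p - 1)) - p * (p + 1) * s ^ (-p - 2) * (t - s))
      (g' := fun t => p * (p + 1) * t ^ (-p - 2) - p * (p + 1) * s ^ (-p - 2))
      (fun t ht => ?_) (fun t ht => ?_) (by simp)
    · have h1 := ((hd1 t (hIpos t ht)).sub_const (-p * s ^ (-p - 1))).sub
        (((hasDerivAt_id t).sub_const s).const_mul (p * (p + 1) * s ^ (-p - 2)))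
      refine h1.congr_deriv ?_
      simp
    · exact (hA t ht).trans (mul_le_mul_of_nonneg_left (abs_sub_le_of_mem_uIcc ht) hL0)
  -- step C: `g₂(t) = φ(t) - φ(s) - φ'(s)(t-s) - φ''(s)(t-s)²/2` has `|g₂ (s+h)| ≤ L h² |h|`
  have hC : ∀ t ∈ uIcc s (s + h),
      |t ^ (-p) - s ^ (-p) - (-p * s ^ (-p - 1)) * (t - s) -
          (p * (p + 1) * s ^ (-p - 2)) * (t - s) ^ 2 / 2| ≤ L * |h| * |h| * |t - s| := by
    refine abs_le_of_hasDerivAt_bound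
      (g := fun t => t ^ (-p) - s ^ (-p) - (-p * s ^ (-p - 1)) * (t - s) -
          (p * (p + 1) * s ^ (-p - 2)) * (t - s) ^ 2 / 2)
      (g' := fun t => -p * t ^ (-p - 1) - (-p * s ^ (-p - 1)) - p * (p + 1) * s ^ (-p - 2) * (t - s))
      (fun t ht => ?_) (fun t ht => ?_) (by simp)
    · have h1 := (((hd0 t (hIpos t ht)).sub_const (s ^ (-p))).sub
        (((hasDerivAt_id t).sub_const s).const_mul (-p * s ^ (-p - 1)))).sub
        ((((hasDerivAt_id t).sub_const s).mul ((hasDerivAt_id t).sub_const s)).const_mul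
          (p * (p + 1) * s ^ (-p - 2) / 2))
      refine (h1.congr_of_eventuallyEq (Filter.Eventually.of_forall fun u => ?_)).congr_deriv ?_
      · simp only [Pi.sub_apply, Pi.mul_apply, id]
        ring
      · simp only [id]
        ring
    · calc |-p * t ^ (-p - 1) - (-p * s ^ (-p - 1)) - p * (p + 1) * s ^ (-p - 2) * (t - s)|
          ≤ L * |h| * |t - s| := hB t ht
        _ ≤ L * |h| * |h| := mul_le_mul_of_nonneg_left (abs_sub_le_of_mem_uIcc ht) (by positivity)
  have key := hC (s + h) right_mem_uIcc
  rw [add_sub_cancel_left] at key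
  calc |(s + h) ^ (-p) - s ^ (-p) - (-p * s ^ (-p - 1)) * h - (p * (p + 1) * s ^ (-p - 2)) * h ^ 2 / 2|
      ≤ L * |h| * |h| * |h| := key
    _ = p * (p + 1) * (p + 2) * m ^ (-p - 3) * |h| ^ 3 := by rw [hL]; ring

/-- `|h|³ = (h²)^{3/2}`. [folklore] -/
theorem abs_pow_three_eq_rpow (h : ℝ) : |h| ^ 3 = (h ^ 2) ^ ((3 : ℝ) / 2) := by
  rw [← sq_abs, ← Real.rpow_two, ← Real.rpow_mul (abs_nonneg h)]
  rw [show (2 : ℝ) * (3 / 2) = ((3 : ℕ) : ℝ) by norm_num, Real.rpow_natCast]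

/-- **The Taylor term at lattice scale**: for `s ≥ 16` and an increment `h` with `s/4 ≤ s + h` and
`h² ≤ 9s` (as for the six nearest-neighbour increments `h = 1 ± 2xᵢ` of `s = ∑ xᵢ²`),
`|(s+h)^{-p} - s^{-p} + p s^{-p-1} h - p(p+1) s^{-p-2} h²/2| ≤ E_p · s^{-p-3/2}` with
`E_p = p(p+1)(p+2) 9^{3/2} / 4^{-p-3}`. [folklore] -/
theorem abs_rpow_neg_taylor_le_lattice {p : ℝ} (hp : 0 < p) {s h : ℝ} (hs : 16 ≤ s)
    (hh1 : s / 4 ≤ s + h) (hh2 : h ^ 2 ≤ 9 * s) :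
    |(s + h) ^ (-p) - s ^ (-p) - (-p * s ^ (-p - 1)) * h - (p * (p + 1) * s ^ (-p - 2)) * h ^ 2 / 2|
      ≤ (p * (p + 1) * (p + 2) / 4 ^ (-p - 3) * 9 ^ ((3 : ℝ) / 2)) * s ^ (-p - 3 / 2) := by
  have hs0 : 0 < s := by linarith
  have key := abs_rpow_neg_taylor_le (m := s / 4) (h := h) hp (by linarith) (by linarith) hh1
  have h3 : |h| ^ 3 ≤ (9 * s) ^ ((3 : ℝ) / 2) := by
    rw [abs_pow_three_eq_rpow]
    exact Real.rpow_le_rpow (sq_nonneg h) hh2 (by norm_num)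
  have hm : (s / 4) ^ (-p - 3) = s ^ (-p - 3) / 4 ^ (-p - 3) :=
    Real.div_rpow hs0.le (by norm_num) _
  have h9 : (9 * s) ^ ((3 : ℝ) / 2) = 9 ^ ((3 : ℝ) / 2) * s ^ ((3 : ℝ) / 2) :=
    Real.mul_rpow (by norm_num) hs0.le
  have hexp : s ^ (-p - 3) * s ^ ((3 : ℝ) / 2) = s ^ (-p - 3 / 2) := by
    rw [← Real.rpow_add hs0]; ring_nf
  have hc0 : 0 ≤ p * (p + 1) * (p + 2) * (s / 4) ^ (-p - 3) := by positivity
  calc |(s + h) ^ (-p) - s ^ (-p) - (-p * s ^ (-p - 1)) * h - (p * (p + 1) * s ^ (-p - 2)) * h ^ 2 / 2|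
      ≤ p * (p + 1) * (p + 2) * (s / 4) ^ (-p - 3) * |h| ^ 3 := key
    _ ≤ p * (p + 1) * (p + 2) * (s / 4) ^ (-p - 3) * (9 * s) ^ ((3 : ℝ) / 2) :=
        mul_le_mul_of_nonneg_left h3 hc0
    _ = (p * (p + 1) * (p + 2) / 4 ^ (-p - 3) * 9 ^ ((3 : ℝ) / 2)) * s ^ (-p - 3 / 2) := by
        rw [hm, h9, ← hexp]; ring

/-! ### The sums of squares of the neighbours -/

/-- A coordinate square is at most the sum of squares. [folklore] -/
theorem sq_apply_le_sumSq (x : Site 3) (i : Fin 3) :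
    ((x i : ℤ) : ℝ) ^ 2 ≤ ∑ j, ((x j : ℤ) : ℝ) ^ 2 :=
  Finset.single_le_sum (f := fun j => ((x j : ℤ) : ℝ) ^ 2) (fun _ _ => sq_nonneg _)
    (Finset.mem_univ i)

/-- The admissibility of the six increments `h = 2a + 1`, `h = 1 - 2a` (`a = xᵢ`, `a² ≤ s`,
`s ≥ 16`): `s/4 ≤ s + h` and `h² ≤ 9s`. [folklore] -/
theorem incr_bounds {s a : ℝ} (hs : 16 ≤ s) (ha : a ^ 2 ≤ s) :
    (s / 4 ≤ s + (2 * a + 1) ∧ (2 * a + 1) ^ 2 ≤ 9 * s) ∧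
      (s / 4 ≤ s + (1 - 2 * a) ∧ (1 - 2 * a) ^ 2 ≤ 9 * s) := by
  refine ⟨⟨?_, ?_⟩, ?_, ?_⟩
  · nlinarith [sq_nonneg (a / 2 + 2)]
  · nlinarith [sq_nonneg (2 * a - 1)]
  · nlinarith [sq_nonneg (a / 2 - 2)]
  · nlinarith [sq_nonneg (2 * a + 1)]

/-! ### The Laplacian of `s^{-p}` -/

/-- **Lattice Taylor expansion of the radial powers on `ℤ³`**: for `p > 0` there is `K ≥ 0` with
`|Δ (s^{-p})(x) - 2p(2p-1) s(x)^{-p-1}| ≤ K s(x)^{-p-3/2}` whenever `s(x) = ∑ᵢ xᵢ² ≥ 16`, where `Δ`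
is the six-neighbour Laplacian `latticeLaplacianZd` of `ℤ³`; in terms of `r = |x|₂ = √s` and
`β = 2p`: `Δ_{ℤ³} r^{-β} = β(β-1) r^{-β-2} + O(r^{-β-3})`. [folklore] -/
theorem latticeLaplacianZd_rpow_neg {p : ℝ} (hp : 0 < p) :
    ∃ K : ℝ, 0 ≤ K ∧ ∀ x : Site 3, 16 ≤ ∑ i, ((x i : ℤ) : ℝ) ^ 2 →
      |latticeLaplacianZd (fun y : Site 3 => (∑ i, ((y i : ℤ) : ℝ) ^ 2) ^ (-p)) x -
          2 * p * (2 * p - 1) * (∑ i, ((x i : ℤ) : ℝ) ^ 2) ^ (-p - 1)|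
        ≤ K * (∑ i, ((x i : ℤ) : ℝ) ^ 2) ^ (-p - 3 / 2) := by
  set E : ℝ := p * (p + 1) * (p + 2) / 4 ^ (-p - 3) * 9 ^ ((3 : ℝ) / 2) with hE
  have hE0 : 0 ≤ E := by positivity
  refine ⟨3 * p * (p + 1) + 6 * E, by positivity, fun x h16 => ?_⟩
  obtain ⟨s, hs⟩ : ∃ s : ℝ, (∑ j, ((x j : ℤ) : ℝ) ^ 2) = s := ⟨_, rfl⟩
  -- the neighbours: `s(x ± eᵢ) = s(x) + (1 ± 2xᵢ)`
  have hadd : ∀ i : Fin 3, (∑ j, (((x + Pi.single i 1 : Site 3) j : ℤ) : ℝ) ^ 2) =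
      (∑ j, ((x j : ℤ) : ℝ) ^ 2) + (2 * ((x i : ℤ) : ℝ) + 1) := by
    intro i; fin_cases i <;> simp [Fin.sum_univ_three] <;> ring
  have hsub : ∀ i : Fin 3, (∑ j, (((x - Pi.single i 1 : Site 3) j : ℤ) : ℝ) ^ 2) =
      (∑ j, ((x j : ℤ) : ℝ) ^ 2) + (1 - 2 * ((x i : ℤ) : ℝ)) := by
    intro i; fin_cases i <;> simp [Fin.sum_univ_three] <;> ring
  have hlap : latticeLaplacianZd (fun y : Site 3 => (∑ i, ((y i : ℤ) : ℝ) ^ 2) ^ (-p)) x =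
      ((s + (2 * ((x 0 : ℤ) : ℝ) + 1)) ^ (-p) + (s + (1 - 2 * ((x 0 : ℤ) : ℝ))) ^ (-p)) +
      ((s + (2 * ((x 1 : ℤ) : ℝ) + 1)) ^ (-p) + (s + (1 - 2 * ((x 1 : ℤ) : ℝ))) ^ (-p)) +
      ((s + (2 * ((x 2 : ℤ) : ℝ) + 1)) ^ (-p) + (s + (1 - 2 * ((x 2 : ℤ) : ℝ))) ^ (-p)) -
      6 * s ^ (-p) := by
    rw [latticeLaplacianZd_three]
    simp only [hadd, hsub, hs]
    rw [Fin.sum_univ_three]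
  have hx0 := sq_apply_le_sumSq x 0
  have hx1 := sq_apply_le_sumSq x 1
  have hx2 := sq_apply_le_sumSq x 2
  rw [hs] at h16 hx0 hx1 hx2 ⊢
  rw [hlap]
  have hs0 : 0 < s := by linarith
  have hs1 : 1 ≤ s := by linarith
  -- the six Taylor bounds
  obtain ⟨⟨h0a, h0b⟩, h0c, h0d⟩ := incr_bounds h16 hx0
  obtain ⟨⟨h1a, h1b⟩, h1c, h1d⟩ := incr_bounds h16 hx1
  obtain ⟨⟨h2a, h2b⟩, h2c, h2d⟩ := incr_bounds h16 hx2
  have T0p := abs_le.1 (abs_rpow_neg_taylor_le_lattice hp h16 h0a h0b)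
  have T0m := abs_le.1 (abs_rpow_neg_taylor_le_lattice hp h16 h0c h0d)
  have T1p := abs_le.1 (abs_rpow_neg_taylor_le_lattice hp h16 h1a h1b)
  have T1m := abs_le.1 (abs_rpow_neg_taylor_le_lattice hp h16 h1c h1d)
  have T2p := abs_le.1 (abs_rpow_neg_taylor_le_lattice hp h16 h2a h2b)
  have T2m := abs_le.1 (abs_rpow_neg_taylor_le_lattice hp h16 h2c h2d)
  rw [← hE] at T0p T0m T1p T1m T2p T2m
  -- the powers of `s`
  set a : ℝ := s ^ (-p - 1) with ha
  set b : ℝ := s ^ (-p - 2) with hb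
  set e : ℝ := s ^ (-p - 3 / 2) with he
  have hba : b * s = a := by
    rw [hb, ha, ← Real.rpow_add_one hs0.ne']; ring_nf
  have hb0 : 0 ≤ b := Real.rpow_nonneg hs0.le _
  have hbe : b ≤ e := Real.rpow_le_rpow_of_exponent_le hs1 (by linarith)
  have hpb : 0 ≤ 3 * p * (p + 1) * b := by positivity
  have hpbe : 3 * p * (p + 1) * b ≤ 3 * p * (p + 1) * e :=
    mul_le_mul_of_nonneg_left hbe (by positivity)
  -- the second-order identity `∑ h = 6`, `∑ h² = 6 + 8s`
  have hsx : s = ((x 0 : ℤ) : ℝ) ^ 2 + ((x 1 : ℤ) : ℝ) ^ 2 + ((x 2 : ℤ) : ℝ) ^ 2 := by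
    rw [← hs, Fin.sum_univ_three]
  set x0 : ℝ := ((x 0 : ℤ) : ℝ) with hx0def
  set x1 : ℝ := ((x 1 : ℤ) : ℝ) with hx1def
  set x2 : ℝ := ((x 2 : ℤ) : ℝ) with hx2def
  have hid : (s + (2 * x0 + 1)) ^ (-p) + (s + (1 - 2 * x0)) ^ (-p) +
      ((s + (2 * x1 + 1)) ^ (-p) + (s + (1 - 2 * x1)) ^ (-p)) +
      ((s + (2 * x2 + 1)) ^ (-p) + (s + (1 - 2 * x2)) ^ (-p)) - 6 * s ^ (-p) -
      2 * p * (2 * p - 1) * a =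
      ((s + (2 * x0 + 1)) ^ (-p) - s ^ (-p) - (-p * a) * (2 * x0 + 1) -
          (p * (p + 1) * b) * (2 * x0 + 1) ^ 2 / 2) +
      ((s + (1 - 2 * x0)) ^ (-p) - s ^ (-p) - (-p * a) * (1 - 2 * x0) -
          (p * (p + 1) * b) * (1 - 2 * x0) ^ 2 / 2) +
      ((s + (2 * x1 + 1)) ^ (-p) - s ^ (-p) - (-p * a) * (2 * x1 + 1) -
          (p * (p + 1) * b) * (2 * x1 + 1) ^ 2 / 2) +
      ((s + (1 - 2 * x1)) ^ (-p) - s ^ (-p) - (-p * a) * (1 - 2 * x1) -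
          (p * (p + 1) * b) * (1 - 2 * x1) ^ 2 / 2) +
      ((s + (2 * x2 + 1)) ^ (-p) - s ^ (-p) - (-p * a) * (2 * x2 + 1) -
          (p * (p + 1) * b) * (2 * x2 + 1) ^ 2 / 2) +
      ((s + (1 - 2 * x2)) ^ (-p) - s ^ (-p) - (-p * a) * (1 - 2 * x2) -
          (p * (p + 1) * b) * (1 - 2 * x2) ^ 2 / 2) +
      3 * p * (p + 1) * b := by
    linear_combination (-4 * p * (p + 1) * b) * hsx + (4 * p * (p + 1)) * hba
  rw [hid, abs_le]
  constructor
  · linarith [T0p.1, T0m.1, T1p.1, T1m.1, T2p.1, T2m.1]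
  · linarith [T0p.2, T0m.2, T1p.2, T1m.2, T2p.2, T2m.2]

end Summit.CriticalPhenomena.Ising3DConformalLimit.Theorems.EtaBoundsFromTelemetry
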